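import Summits.QuantumFields.YangMills.Theorems.UnitScaleTiltProp7CornerCombChainPerCorner
import Summits.QuantumFields.YangMills.Theorems.UnitScaleTiltProp7CornerCombTopPair
import Summits.QuantumFields.YangMills.Theorems.UnitScaleTiltProp7CornerCombInCellPoincare
import HarnessLib

/-!
# (n3)-COMB (II) «COMB = STRAIGHT ∘ BLOCK-AXIAL», file F-6c-3c: THE DRESSED PER-CORNER ROW — the covariant coarse gradient of the accumulated comb gauge function `Λ_{k′+1}` at ONE
# level-`(k′+1)` bond `(z, κ)`, bounded by the TOP PAIR (✓F-6c-3b), the in-cell OSCILLATIONS (✓F-6a-2) — both written out in gradient ∕ mass letters — and the ONE-SCALE rows of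
# F-6c-2 (kept as displayed hypotheses `hstep`, `hstep'` in ★routeR-w1 g9's announced output shape), through the abstract chain ✓F-6c-3a (organisation β of PENS ROUND 3, 2026-08-29)

Crux `stmt-QuantumFields-19200` `MinimiserStabilityRegPr`, route-R E′ (A′)-on-Σ, package P-A2, row (β); the DISPLAYED route-internal row `hMcomb` («(n3)-comb», SIGNATURE-0,
★★OWNER RULINGS №19 O4 ∕ №22; OPEN, XL) and its supplier design (II) (MASTER `DESIGN-N3COMB-LINEAR-CORE` 6efb31c3 §1 rows 6–8, §5 F-6c∕F-6d; PENS ROUND 3 2026-08-29T08:01:48Z (iv);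
★routeR-w1 g9 08:29:08Z «F-6c-3 = w3-19200 g13 OF RECORD; 3a∕3b split YES; F-6c-2 OUTPUT SHAPE»).  Seat `ym-ust-19200-w3` g13; `--kind proof --supports stmt-QuantumFields-19200 --as helper`;
THEOREMS ONLY (0 `def`, 0 `sorry`); «(O2) groundwork — not consumed by any displayed row before the freeze lifts»; count-neutral.  YM₃ on T³ is a ladder rung (R3), NOT d = 4, NOT infinite
volume, NOT the Clay problem; nothing here is progress on the YM mass gap; nothing of `hMcomb` ∕ `hMcomb₂` ∕ (β) ∕ `hD` ∕ the stub ∕ the crux is proved or claimed.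

## The assembly
Letters (`M_N(ℂ)`, operator norm; `ℤᵈ`): a tower of `U1`-valued backgrounds `V i` (the consumer's `Ū₀^{(i)} = avgIter L U₀ i`; only `V (k′+1)(z,κ) = V̄^{(k′)}(L•z, κ)` is used, lit `avgIter_succ`),
level fields `G i`, the accumulated gauge function of ✓`Prop7CornerCombStructure.cornerComb_structure` with the CORNERED COMB MEAN `CM i X z′ := FhatCov L (V i) X (L•z′)` (F-5a's letter):
`Λ 0 = 0`, `Λ (i+1) z′ = FhatCov L (V i) (G i) (L•z′) + Λ i (L•z′)`.  The comb-transported block means `X̄ᵀ(V, X, q, μ) := L⁻ᵈ • Σ_s Ad_{V(Γ_{q,q+s})} X(q+s, μ)` (✓F-6a-2's letter at block side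
`L`).  At the corner `z` of level `k′+1` the level-`i` corner is `q_i = L^{k′+1−i}•z`.
* §1 `fhatCov_eq_drift_add_osc` — the tautological split `F̂ = Σ_μ ((L−1)∕2·Lⁱ)•(L⁻ⁱ•X̄ᵀ_μ) + (F̂ − Σ_μ ((L−1)∕2)•X̄ᵀ_μ)` in ✓F-6c-3a's `(wᵢ, a i μ, o i)` letters; `conjR_fhatCov_eq_drift_add_osc` its transport.
* §2 ★★★ `normSq_covGrad_gauge_le` — THE DRESSED PER-CORNER ROW: for `2 ≤ L`, plaquettes of `V i` within `a i`, the top loop window `w ≤ 1∕8` at `(L•z, κ)`, `V̄^{(k′)}(L•z,κ) ∈ U1`, and the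
  one-scale rows `hstep`∕`hstep'` (F-6c-2's ★`normSq_invL_meanT_step_sub_meanT_le` shape: `‖L⁻¹ • X̄ᵀ(V (j+1), G (j+1), q_{j+1}, μ) − X̄ᵀ(V j, G j, q_j, μ)‖² ≤ E j μ`, `j < k′`, at `z` and at `z + e_κ`):
  `‖Λ (k′+1) z − Ad_{V̄^{(k′)}(L•z,κ)} Λ (k′+1) (z+e_κ)‖² ≤ 3·( d·((L^{k′+1}−1)∕2)²·L^{−2k′}·Σ_μ TOP_μ + 2d·c_L·Σ_{j<k′}(√L)^{k′−1−j}·((L^{j+1}−1)∕2)²·L^{−2j}·Σ_μ(E j μ + E′ j μ) + 2c_L·Σ_{i≤k′}(√L)^{k′−i}·(OSC_i(z) + OSC_i(z+e_κ)) )`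
  with `TOP_μ` = ✓F-6c-3b `normSq_blockMean_sub_conjR_bavg_blockMean_le`'s right side at `(V k′, G k′ (·) μ, L•z)` and `OSC_i(y)` = ✓F-6a-2 `norm_FhatCov_sub_drift_sq_le`'s right side at
  `(V i, a i, G i, L^{k′+1−i}•y)` — both WRITTEN OUT (covariant gradient energies and `a²`∕`w²`-weighted masses on the blocks ∕ double blocks at the corner chain), `c_L = (1 − (√L)⁻¹)⁻¹`.
  Constants closed in `(d, L, N)`; nothing reads `k′` beyond the displayed sums, no torus, no `K`, no member ((g1)(g2)).  F-6d (w5-19200 g8) sums this over the level-`(k′+1)` cell and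
  discharges `E` by F-6c-2; ✓F-6b∕✓F-5c turn the level energies into `Σ‖∇^{U₀}Y₀‖²` and DEF.
HONEST: an assembly by name (✓F-6c-3a ∘ ✓F-6c-3b ∘ ✓F-6a-2) plus `smul` bookkeeping; the one-scale rows are hypotheses; no estimate of Bałaban's beyond the cited tree theorems.
References: T. Bałaban, CMP 98 (1985) 17–51 [Balaban1985Averaging] ((42)–(47) pp.23–25, (112) p.34); CMP 95 (1984) 17–40 [Balaban1984PropagatorsI] ((1.18)–(1.20) pp.19–20);
CMP 96 (1984) 223–250 [Balaban1984PropagatorsII] ((1.9) p.226); [Balaban1983RegularityDecay] ((2.27) p.580).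
-/

set_option autoImplicit false

noncomputable section

open scoped BigOperators Matrix.Norms.L2Operator
open Finset

namespace Summit.QuantumFields.YangMills.Theorems.Prop7CornerCombChainPerCornerDressed

open Literature.MathematicalPhysics.QuantumFieldTheory.Balaban1983to89
open B7Prop1Explicit (Site Letter e hol seg treeWord boxVec disp plaqWord l1 U1 mem_U1 hol_mem Wcx bavg)
open B7Eq78Linearization (conjR conjR_apply conjR_add conjR_sub conjR_smul_real)
open B7Prop3GeneralRotated (norm_conjR_le)
open B7Prop3GeneralLinear (FhatCov)
open Summit.QuantumFields.YangMills.Theorems.Prop7CornerCombChainPerCorner (normSq_covGrad_le_of_rows covGrad_gauge_eq_sum normSq_conjR_sub_conjR_le normSq_conjR_le)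
open Summit.QuantumFields.YangMills.Theorems.Prop7CornerCombTopPair (normSq_blockMean_sub_conjR_bavg_blockMean_le)
open Summit.QuantumFields.YangMills.Theorems.Prop7CornerCombInCellPoincare (norm_FhatCov_sub_drift_sq_le)

variable {d N : ℕ} [NeZero N]

/-! ## §1 The drift ∕ oscillation split of a corner charge in ✓F-6c-3a's letters -/

omit [NeZero N] in
/-- **THE TAUTOLOGICAL SPLIT OF A CORNER CHARGE**: for `L ≥ 1`, any `V`, `X`, `q` and level index `i`,
`F̂_V(X)(q) = Σ_μ ((L−1)∕2·Lⁱ) • ((Lⁱ)⁻¹ • X̄ᵀ_μ(q)) + (F̂_V(X)(q) − Σ_μ ((L−1)∕2) • X̄ᵀ_μ(q))` — the drift weights of ✓F-6c-3a against the normalised transported block means, plus the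
oscillation that ✓F-6a-2 bounds. [cite: Balaban1985Averaging, (112) p.34, pp.24-25] -/
theorem fhatCov_eq_drift_add_osc (L : ℕ) (hL : L ≠ 0) (V : Site d → Fin d → (Matrix (Fin N) (Fin N) ℂ)ˣ) (X : Site d → Fin d → Matrix (Fin N) (Fin N) ℂ)
    (q : Site d) (i : ℕ) :
    FhatCov L V X q
      = (∑ μ : Fin d, (((L : ℝ) - 1) / 2 * (L : ℝ) ^ i) • (((L : ℝ) ^ i)⁻¹ • ((((L : ℝ) ^ d)⁻¹) •
            ∑ s : Fin d → Fin L, conjR (hol V q (treeWord (boxVec L s))) (X (q + boxVec L s) μ))))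
        + (FhatCov L V X q - ∑ μ : Fin d, (((L : ℝ) - 1) / 2) • ((((L : ℝ) ^ d)⁻¹) •
            ∑ s : Fin d → Fin L, conjR (hol V q (treeWord (boxVec L s))) (X (q + boxVec L s) μ))) := by
  have hLi : ((L : ℝ) ^ i) ≠ 0 := pow_ne_zero _ (by exact_mod_cast hL)
  have hw : ∀ μ : Fin d, (((L : ℝ) - 1) / 2 * (L : ℝ) ^ i) • (((L : ℝ) ^ i)⁻¹ • ((((L : ℝ) ^ d)⁻¹) •
      ∑ s : Fin d → Fin L, conjR (hol V q (treeWord (boxVec L s))) (X (q + boxVec L s) μ)))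
      = (((L : ℝ) - 1) / 2) • ((((L : ℝ) ^ d)⁻¹) • ∑ s : Fin d → Fin L, conjR (hol V q (treeWord (boxVec L s))) (X (q + boxVec L s) μ)) := by
    intro μ
    rw [smul_smul, mul_assoc, mul_inv_cancel₀ hLi, mul_one]
  simp only [hw]
  abel

/-- **THE IN-CELL OSCILLATION ROW AT BLOCK SIDE `L`** (✓F-6a-2 `norm_FhatCov_sub_drift_sq_le` re-read with the block side written `L` instead of `n + 1`; the only changes are the casts
`n = L − 1` and the last-column predicate `s ν ≠ last ↔ s ν + 1 ≠ L`): `‖F̂ − Σ_μ ((L−1)∕2)•X̄ᵀ_μ‖² ≤ (N∕2)d²(L−1)²L²·GRAD^{cov}_B(X) + (8d⁶(L−1)⁶ + 2N d⁵(L−1)⁴L²)·a²·MASS_B(X)`.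
[cite: Balaban1985Averaging, (112) p.34, pp.24-25; Balaban1983RegularityDecay, (2.27) p.580] -/
theorem normSq_osc_le (L : ℕ) [NeZero L] (V : Site d → Fin d → (Matrix (Fin N) (Fin N) ℂ)ˣ) (hV : ∀ x κ, V x κ ∈ U1 (Matrix (Fin N) (Fin N) ℂ)) {a : ℝ} (ha : 0 ≤ a)
    (hplaq : ∀ (x : Site d) (κ μ : Fin d), κ ≠ μ → ‖((hol V x (plaqWord κ μ) : (Matrix (Fin N) (Fin N) ℂ)ˣ) : Matrix (Fin N) (Fin N) ℂ) - 1‖ ≤ a)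
    (X : Site d → Fin d → Matrix (Fin N) (Fin N) ℂ) (q : Site d) :
    ‖FhatCov L V X q - ∑ μ : Fin d, (((L : ℝ) - 1) / 2) • ((((L : ℝ) ^ d)⁻¹) •
        ∑ s : Fin d → Fin L, conjR (hol V q (treeWord (boxVec L s))) (X (q + boxVec L s) μ))‖ ^ 2
      ≤ N / 2 * (d : ℝ) ^ 2 * ((L : ℝ) - 1) ^ 2 * (L : ℝ) ^ 2 *
          ∑ μ : Fin d, ∑ ν : Fin d, ∑ s ∈ univ.filter (fun s : Fin d → Fin L => (s ν : ℕ) + 1 ≠ L),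
            ‖conjR (V (q + boxVec L s) ν) (X (q + boxVec L s + e ν) μ) - X (q + boxVec L s) μ‖ ^ 2
        + (8 * (d : ℝ) ^ 6 * ((L : ℝ) - 1) ^ 6 + 2 * N * (d : ℝ) ^ 5 * ((L : ℝ) - 1) ^ 4 * (L : ℝ) ^ 2) * a ^ 2 *
          ∑ s : Fin d → Fin L, ∑ μ : Fin d, ‖X (q + boxVec L s) μ‖ ^ 2 := by
  obtain ⟨n, rfl⟩ : ∃ n, L = n + 1 := ⟨L - 1, (Nat.succ_pred_eq_of_ne_zero (NeZero.ne L)).symm⟩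
  have h := norm_FhatCov_sub_drift_sq_le n V hV ha hplaq X q
  have hfilt : ∀ ν : Fin d, univ.filter (fun s : Fin d → Fin (n + 1) => (s ν : ℕ) + 1 ≠ n + 1) = univ.filter (fun s : Fin d → Fin (n + 1) => s ν ≠ Fin.last n) := by
    intro ν
    refine Finset.filter_congr fun s _ => ?_
    rw [Ne, Ne, Fin.ext_iff, Fin.val_last]
    omega
  simp only [Nat.cast_succ, add_sub_cancel_right, hfilt]
  exact h

/-! ## §2 ★★★ The dressed per-corner row -/

/-- ★★★ **THE DRESSED PER-CORNER ROW (organisation β; PENS ROUND 3 (iv))**.  Tower `V i` of `U1`-valued backgrounds on `ℤᵈ` with plaquettes within `a i ≥ 0` of `1` (`i ≤ k′`), the loop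
variables of the top averaged bond `⟨L•z, L•z + L•e_κ⟩` within `w ≤ 1∕8`, that averaged bond `V̄^{(k′)}(L•z, κ)` in `U1`; level fields `G i`; `Λ` the accumulated gauge function of the
CORNERED COMB MEANS (`Λ 0 = 0`, `Λ (i+1) z′ = FhatCov L (V i) (G i) (L•z′) + Λ i (L•z′)`); one-scale rows `hstep`∕`hstep'` at the corner chains of `z` and of `z + e_κ` (F-6c-2's shape, abstract
right sides `E`, `E′`).  THEN the covariant coarse gradient of `Λ (k′+1)` at `(z, κ)` through `V̄^{(k′)}(L•z,κ)` obeys the displayed bound: TOP PAIR (✓F-6c-3b, weight `((L^{k′+1}−1)∕2)²·L^{−2k′}`),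
ONE-SCALE rows (weights `(√L)^{k′−1−j}·((L^{j+1}−1)∕2)²·L^{−2j} ≤ (√L)^{k′−1−j}·L²∕4`), OSCILLATIONS (✓F-6a-2, weights `(√L)^{k′−i}`), `c_L = (1 − (√L)⁻¹)⁻¹` — via ✓F-6c-3a
`normSq_covGrad_le_of_rows` with `a i μ := (Lⁱ)⁻¹ • X̄ᵀ(V i, G i, q_i, μ)`, `b i μ := Ad((Lⁱ)⁻¹ • X̄ᵀ(V i, G i, q_i′, μ))`, `o i := F̂ − drift`, `p i := Ad(o at q_i′)`.
[cite: Balaban1985Averaging, (42)-(47) pp.23-25, (112) p.34; Balaban1984PropagatorsI, (1.18)-(1.20) pp.19-20; Balaban1984PropagatorsII, (1.9) p.226; Balaban1983RegularityDecay, (2.27) p.580] -/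
theorem normSq_covGrad_gauge_le (L : ℕ) (hL : 2 ≤ L) (k' : ℕ)
    (V : ℕ → Site d → Fin d → (Matrix (Fin N) (Fin N) ℂ)ˣ) (hV : ∀ i x μ, V i x μ ∈ U1 (Matrix (Fin N) (Fin N) ℂ))
    (a : ℕ → ℝ) (ha : ∀ i, 0 ≤ a i)
    (hplaq : ∀ i, i ≤ k' → ∀ (x : Site d) (μ ν : Fin d), μ ≠ ν → ‖((hol (V i) x (plaqWord μ ν) : (Matrix (Fin N) (Fin N) ℂ)ˣ) : Matrix (Fin N) (Fin N) ℂ) - 1‖ ≤ a i)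
    (z : Site d) (κ : Fin d) {w : ℝ}
    (hw : ∀ r : Fin d → Fin L, ‖((Wcx L (V k') ((L : ℤ) • z) κ (boxVec L r) : (Matrix (Fin N) (Fin N) ℂ)ˣ) : Matrix (Fin N) (Fin N) ℂ) - 1‖ ≤ w) (hw8 : w ≤ 1 / 8)
    (hbU : bavg L (V k') ((L : ℤ) • z) κ ∈ U1 (Matrix (Fin N) (Fin N) ℂ))
    (G : ℕ → Site d → Fin d → Matrix (Fin N) (Fin N) ℂ) (Λ : ℕ → Site d → Matrix (Fin N) (Fin N) ℂ) (hΛ0 : ∀ y, Λ 0 y = 0)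
    (hΛs : ∀ (i : ℕ) (y : Site d), Λ (i + 1) y = FhatCov L (V i) (G i) ((L : ℤ) • y) + Λ i ((L : ℤ) • y))
    (E E' : ℕ → Fin d → ℝ)
    (hstep : ∀ j, j < k' → ∀ μ : Fin d,
      ‖((L : ℝ)⁻¹ • ((((L : ℝ) ^ d)⁻¹) • ∑ s : Fin d → Fin L,
            conjR (hol (V (j + 1)) (((L : ℤ) ^ (k' - j)) • z) (treeWord (boxVec L s))) (G (j + 1) (((L : ℤ) ^ (k' - j)) • z + boxVec L s) μ)))
        - ((((L : ℝ) ^ d)⁻¹) • ∑ s : Fin d → Fin L,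
            conjR (hol (V j) (((L : ℤ) ^ (k' + 1 - j)) • z) (treeWord (boxVec L s))) (G j (((L : ℤ) ^ (k' + 1 - j)) • z + boxVec L s) μ))‖ ^ 2 ≤ E j μ)
    (hstep' : ∀ j, j < k' → ∀ μ : Fin d,
      ‖((L : ℝ)⁻¹ • ((((L : ℝ) ^ d)⁻¹) • ∑ s : Fin d → Fin L,
            conjR (hol (V (j + 1)) (((L : ℤ) ^ (k' - j)) • (z + e κ)) (treeWord (boxVec L s))) (G (j + 1) (((L : ℤ) ^ (k' - j)) • (z + e κ) + boxVec L s) μ)))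
        - ((((L : ℝ) ^ d)⁻¹) • ∑ s : Fin d → Fin L,
            conjR (hol (V j) (((L : ℤ) ^ (k' + 1 - j)) • (z + e κ)) (treeWord (boxVec L s))) (G j (((L : ℤ) ^ (k' + 1 - j)) • (z + e κ) + boxVec L s) μ))‖ ^ 2 ≤ E' j μ) :
    ‖Λ (k' + 1) z - conjR (bavg L (V k') ((L : ℤ) • z) κ) (Λ (k' + 1) (z + e κ))‖ ^ 2
      ≤ 3 * ((d : ℝ) * (((L : ℝ) ^ (k' + 1) - 1) / 2) ^ 2 * ∑ μ : Fin d, (((L : ℝ) ^ k')⁻¹ ^ 2 *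
              (2 * ((L : ℝ) ^ d)⁻¹ * (L : ℝ) * ∑ s : Fin d → Fin L, ∑ t ∈ range L,
                  ‖conjR (V k' ((L : ℤ) • z + boxVec L s + (t : ℤ) • e κ) κ) (G k' ((L : ℤ) • z + boxVec L s + (t : ℤ) • e κ + e κ) μ) - G k' ((L : ℤ) • z + boxVec L s + (t : ℤ) • e κ) μ‖ ^ 2
                + 2 * ((L : ℝ) ^ d)⁻¹ * (8 * (((d : ℝ) + 1) * (L : ℝ)) ^ 2 * a k' + 8 * w) ^ 2 * ∑ s : Fin d → Fin L, ‖G k' ((L : ℤ) • z + (L : ℤ) • e κ + boxVec L s) μ‖ ^ 2))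
          + 2 * (d : ℝ) * (1 - (Real.sqrt L)⁻¹)⁻¹
              * ∑ j ∈ range k', (Real.sqrt L) ^ (k' - 1 - j) * (((L : ℝ) ^ (j + 1) - 1) / 2) ^ 2 * ∑ μ : Fin d, (((L : ℝ) ^ j)⁻¹ ^ 2 * E j μ + ((L : ℝ) ^ j)⁻¹ ^ 2 * E' j μ)
          + 2 * (1 - (Real.sqrt L)⁻¹)⁻¹ * ∑ i ∈ range (k' + 1), (Real.sqrt L) ^ (k' - i) *
              ((N / 2 * (d : ℝ) ^ 2 * ((L : ℝ) - 1) ^ 2 * (L : ℝ) ^ 2 *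
                  ∑ μ : Fin d, ∑ ν : Fin d, ∑ s ∈ univ.filter (fun s : Fin d → Fin L => (s ν : ℕ) + 1 ≠ L),
                    ‖conjR (V i (((L : ℤ) ^ (k' + 1 - i)) • z + boxVec L s) ν) (G i (((L : ℤ) ^ (k' + 1 - i)) • z + boxVec L s + e ν) μ) - G i (((L : ℤ) ^ (k' + 1 - i)) • z + boxVec L s) μ‖ ^ 2
                + (8 * (d : ℝ) ^ 6 * ((L : ℝ) - 1) ^ 6 + 2 * N * (d : ℝ) ^ 5 * ((L : ℝ) - 1) ^ 4 * (L : ℝ) ^ 2) * a i ^ 2 *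
                  ∑ s : Fin d → Fin L, ∑ μ : Fin d, ‖G i (((L : ℤ) ^ (k' + 1 - i)) • z + boxVec L s) μ‖ ^ 2)
              + (N / 2 * (d : ℝ) ^ 2 * ((L : ℝ) - 1) ^ 2 * (L : ℝ) ^ 2 *
                  ∑ μ : Fin d, ∑ ν : Fin d, ∑ s ∈ univ.filter (fun s : Fin d → Fin L => (s ν : ℕ) + 1 ≠ L),
                    ‖conjR (V i (((L : ℤ) ^ (k' + 1 - i)) • (z + e κ) + boxVec L s) ν) (G i (((L : ℤ) ^ (k' + 1 - i)) • (z + e κ) + boxVec L s + e ν) μ) - G i (((L : ℤ) ^ (k' + 1 - i)) • (z + e κ) + boxVec L s) μ‖ ^ 2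
                + (8 * (d : ℝ) ^ 6 * ((L : ℝ) - 1) ^ 6 + 2 * N * (d : ℝ) ^ 5 * ((L : ℝ) - 1) ^ 4 * (L : ℝ) ^ 2) * a i ^ 2 *
                  ∑ s : Fin d → Fin L, ∑ μ : Fin d, ‖G i (((L : ℤ) ^ (k' + 1 - i)) • (z + e κ) + boxVec L s) μ‖ ^ 2))) := by
  classical
  -- scalars
  have hLne : L ≠ 0 := by omega
  haveI : NeZero L := ⟨hLne⟩
  have hL1 : (1 : ℝ) < (L : ℝ) := by exact_mod_cast (lt_of_lt_of_le one_lt_two hL)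
  have hL0 : (0 : ℝ) < (L : ℝ) := zero_lt_one.trans hL1
  have hk : 1 ≤ k' + 1 := Nat.succ_le_succ (Nat.zero_le _)
  -- the transport of record and the corner chains
  set u : (Matrix (Fin N) (Fin N) ℂ)ˣ := bavg L (V k') ((L : ℤ) • z) κ with hu
  have huU : u ∈ U1 (Matrix (Fin N) (Fin N) ℂ) := hbU
  set cz : ℕ → Site d := fun i => ((L : ℤ) ^ (k' + 1 - i)) • z with hcz
  set cz' : ℕ → Site d := fun i => ((L : ℤ) ^ (k' + 1 - i)) • (z + e κ) with hcz'
  -- transported block means, corner charges, and the ✓F-6c-3a data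
  set Xb : ℕ → Fin d → Matrix (Fin N) (Fin N) ℂ := fun i μ => (((L : ℝ) ^ d)⁻¹) •
    ∑ s : Fin d → Fin L, conjR (hol (V i) (cz i) (treeWord (boxVec L s))) (G i (cz i + boxVec L s) μ) with hXb
  set Xb' : ℕ → Fin d → Matrix (Fin N) (Fin N) ℂ := fun i μ => (((L : ℝ) ^ d)⁻¹) •
    ∑ s : Fin d → Fin L, conjR (hol (V i) (cz' i) (treeWord (boxVec L s))) (G i (cz' i + boxVec L s) μ) with hXb'
  set wt : ℕ → ℝ := fun i => ((L : ℝ) - 1) / 2 * (L : ℝ) ^ i with hwt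
  set a₀ : ℕ → Fin d → Matrix (Fin N) (Fin N) ℂ := fun i μ => ((L : ℝ) ^ i)⁻¹ • Xb i μ with ha₀
  set b₀ : ℕ → Fin d → Matrix (Fin N) (Fin N) ℂ := fun i μ => conjR u (((L : ℝ) ^ i)⁻¹ • Xb' i μ) with hb₀
  set o₀ : ℕ → Matrix (Fin N) (Fin N) ℂ := fun i => FhatCov L (V i) (G i) (cz i) - ∑ μ : Fin d, (((L : ℝ) - 1) / 2) • Xb i μ with ho₀
  set p₀ : ℕ → Matrix (Fin N) (Fin N) ℂ := fun i => conjR u (FhatCov L (V i) (G i) (cz' i) - ∑ μ : Fin d, (((L : ℝ) - 1) / 2) • Xb' i μ) with hp₀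
  -- (A) the corner charges in the (w, a, o) ∕ (w, b, p) letters
  have hFh : ∀ i, FhatCov L (V i) (G i) (cz i) = (∑ μ : Fin d, wt i • a₀ i μ) + o₀ i := fun i =>
    fhatCov_eq_drift_add_osc L hLne (V i) (G i) (cz i) i
  have hFh' : ∀ i, conjR u (FhatCov L (V i) (G i) (cz' i)) = (∑ μ : Fin d, wt i • b₀ i μ) + p₀ i := by
    intro i
    have h1 := fhatCov_eq_drift_add_osc L hLne (V i) (G i) (cz' i) i
    have hsum : conjR u (∑ μ : Fin d, wt i • (((L : ℝ) ^ i)⁻¹ • Xb' i μ)) = ∑ μ : Fin d, conjR u (wt i • (((L : ℝ) ^ i)⁻¹ • Xb' i μ)) :=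
      map_sum (AddMonoidHom.mk' (conjR u) (conjR_add u)) _ _
    rw [h1, conjR_add, hsum]
    simp only [conjR_smul_real, hb₀, hp₀, hwt, hXb']
  -- (B) the covariant coarse gradient of `Λ (k'+1)` as the ✓F-6c-3a difference
  have hLHS : Λ (k' + 1) z - conjR u (Λ (k' + 1) (z + e κ))
      = (∑ i ∈ range (k' + 1), ((∑ μ : Fin d, wt i • a₀ i μ) + o₀ i)) - ∑ i ∈ range (k' + 1), ((∑ μ : Fin d, wt i • b₀ i μ) + p₀ i) := by
    have h : Λ (k' + 1) z - conjR u (Λ (k' + 1) (z + e κ))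
        = ∑ i ∈ range (k' + 1), (FhatCov L (V i) (G i) ((L : ℤ) • (((L : ℤ) ^ (k' + 1 - 1 - i)) • z))
            - conjR u (FhatCov L (V i) (G i) ((L : ℤ) • (((L : ℤ) ^ (k' + 1 - 1 - i)) • (z + e κ))))) :=
      covGrad_gauge_eq_sum L (fun i X y => FhatCov L (V i) X ((L : ℤ) • y)) G Λ hΛ0 (fun i y => hΛs i y) u (k' + 1) z κ
    rw [h, ← Finset.sum_sub_distrib]
    refine Finset.sum_congr rfl fun i hi => ?_
    have hik : i ≤ k' := Nat.lt_succ_iff.mp (Finset.mem_range.mp hi)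
    have hpow : ∀ y : Site d, (L : ℤ) • (((L : ℤ) ^ (k' + 1 - 1 - i)) • y) = ((L : ℤ) ^ (k' + 1 - i)) • y := by
      intro y
      rw [smul_smul, ← pow_succ', show k' + 1 - 1 - i + 1 = k' + 1 - i by omega]
    rw [hpow, hpow, ← hFh i, ← hFh' i]
  -- (C) the five hypothesis families of ✓F-6c-3a
  -- one-scale rows at `z`
  have hpowR : ∀ j : ℕ, ((L : ℝ) ^ (j + 1))⁻¹ = ((L : ℝ) ^ j)⁻¹ * (L : ℝ)⁻¹ := fun j => by rw [pow_succ, mul_inv]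
  have hcz_succ : ∀ j, j < k' → cz (j + 1) = ((L : ℤ) ^ (k' - j)) • z := fun j hj => by
    simp only [hcz]; rw [show k' + 1 - (j + 1) = k' - j by omega]
  have hcz'_succ : ∀ j, j < k' → cz' (j + 1) = ((L : ℤ) ^ (k' - j)) • (z + e κ) := fun j hj => by
    simp only [hcz']; rw [show k' + 1 - (j + 1) = k' - j by omega]
  have hA1 : ∀ j, j + 1 < k' + 1 → ∀ μ, ‖a₀ (j + 1) μ - a₀ j μ‖ ^ 2 ≤ ((L : ℝ) ^ j)⁻¹ ^ 2 * E j μ := by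
    intro j hj μ
    have hjk : j < k' := by omega
    have hs := hstep j hjk μ
    have e1 : a₀ (j + 1) μ - a₀ j μ = ((L : ℝ) ^ j)⁻¹ • (((L : ℝ)⁻¹ • Xb (j + 1) μ) - Xb j μ) := by
      simp only [ha₀, hpowR j, smul_sub, ← smul_smul]
    rw [e1, norm_smul, mul_pow, Real.norm_of_nonneg (inv_nonneg.2 (pow_nonneg hL0.le _))]
    refine mul_le_mul_of_nonneg_left ?_ (sq_nonneg _)
    have e2 : Xb (j + 1) μ = (((L : ℝ) ^ d)⁻¹) • ∑ s : Fin d → Fin L,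
        conjR (hol (V (j + 1)) (((L : ℤ) ^ (k' - j)) • z) (treeWord (boxVec L s))) (G (j + 1) (((L : ℤ) ^ (k' - j)) • z + boxVec L s) μ) := by
      simp only [hXb, hcz_succ j hjk]
    rw [e2]
    exact hs
  -- one-scale rows at `z + e κ`, transported
  have hB1 : ∀ j, j + 1 < k' + 1 → ∀ μ, ‖b₀ (j + 1) μ - b₀ j μ‖ ^ 2 ≤ ((L : ℝ) ^ j)⁻¹ ^ 2 * E' j μ := by
    intro j hj μ
    have hjk : j < k' := by omega
    have hs := hstep' j hjk μ
    refine (normSq_conjR_sub_conjR_le huU _ _).trans ?_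
    have e1 : ((L : ℝ) ^ (j + 1))⁻¹ • Xb' (j + 1) μ - ((L : ℝ) ^ j)⁻¹ • Xb' j μ = ((L : ℝ) ^ j)⁻¹ • (((L : ℝ)⁻¹ • Xb' (j + 1) μ) - Xb' j μ) := by
      simp only [hpowR j, smul_sub, ← smul_smul]
    rw [e1, norm_smul, mul_pow, Real.norm_of_nonneg (inv_nonneg.2 (pow_nonneg hL0.le _))]
    refine mul_le_mul_of_nonneg_left ?_ (sq_nonneg _)
    have e2 : Xb' (j + 1) μ = (((L : ℝ) ^ d)⁻¹) • ∑ s : Fin d → Fin L,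
        conjR (hol (V (j + 1)) (((L : ℤ) ^ (k' - j)) • (z + e κ)) (treeWord (boxVec L s))) (G (j + 1) (((L : ℤ) ^ (k' - j)) • (z + e κ) + boxVec L s) μ) := by
      simp only [hXb', hcz'_succ j hjk]
    rw [e2]
    exact hs
  -- the top pair (✓F-6c-3b)
  have hczk : cz k' = (L : ℤ) • z := by simp only [hcz]; rw [show k' + 1 - k' = 1 by omega, pow_one]
  have hczk' : cz' k' = (L : ℤ) • z + (L : ℤ) • e κ := by simp only [hcz']; rw [show k' + 1 - k' = 1 by omega, pow_one, smul_add]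
  have hP1 : ∀ μ, ‖a₀ k' μ - b₀ k' μ‖ ^ 2 ≤ ((L : ℝ) ^ k')⁻¹ ^ 2 *
      (2 * ((L : ℝ) ^ d)⁻¹ * (L : ℝ) * ∑ s : Fin d → Fin L, ∑ t ∈ range L,
          ‖conjR (V k' ((L : ℤ) • z + boxVec L s + (t : ℤ) • e κ) κ) (G k' ((L : ℤ) • z + boxVec L s + (t : ℤ) • e κ + e κ) μ) - G k' ((L : ℤ) • z + boxVec L s + (t : ℤ) • e κ) μ‖ ^ 2
        + 2 * ((L : ℝ) ^ d)⁻¹ * (8 * (((d : ℝ) + 1) * (L : ℝ)) ^ 2 * a k' + 8 * w) ^ 2 * ∑ s : Fin d → Fin L, ‖G k' ((L : ℤ) • z + (L : ℤ) • e κ + boxVec L s) μ‖ ^ 2) := by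
    intro μ
    have htop := normSq_blockMean_sub_conjR_bavg_blockMean_le L (V k') (hV k') (ha k') (hplaq k' le_rfl) ((L : ℤ) • z) κ hw hw8 hbU (fun y => G k' y μ)
    have e1 : a₀ k' μ - b₀ k' μ = ((L : ℝ) ^ k')⁻¹ • (Xb k' μ - conjR u (Xb' k' μ)) := by
      simp only [ha₀, hb₀, conjR_smul_real, smul_sub]
    rw [e1, norm_smul, mul_pow, Real.norm_of_nonneg (inv_nonneg.2 (pow_nonneg hL0.le _))]
    refine mul_le_mul_of_nonneg_left ?_ (sq_nonneg _)
    have e2 : Xb k' μ - conjR u (Xb' k' μ)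
        = ((((L : ℝ) ^ d)⁻¹) • ∑ s : Fin d → Fin L, conjR (hol (V k') ((L : ℤ) • z) (treeWord (boxVec L s))) (G k' ((L : ℤ) • z + boxVec L s) μ))
          - conjR (bavg L (V k') ((L : ℤ) • z) κ) ((((L : ℝ) ^ d)⁻¹) • ∑ s : Fin d → Fin L,
              conjR (hol (V k') ((L : ℤ) • z + (L : ℤ) • e κ) (treeWord (boxVec L s))) (G k' ((L : ℤ) • z + (L : ℤ) • e κ + boxVec L s) μ)) := by
      simp only [hXb, hXb', hczk, hczk', hu]
    rw [e2]
    exact htop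
  -- the oscillations (✓F-6a-2 at block side `L`)
  have hO1 : ∀ i, i < k' + 1 → ‖o₀ i‖ ^ 2 ≤
      N / 2 * (d : ℝ) ^ 2 * ((L : ℝ) - 1) ^ 2 * (L : ℝ) ^ 2 *
          ∑ μ : Fin d, ∑ ν : Fin d, ∑ s ∈ univ.filter (fun s : Fin d → Fin L => (s ν : ℕ) + 1 ≠ L),
            ‖conjR (V i (cz i + boxVec L s) ν) (G i (cz i + boxVec L s + e ν) μ) - G i (cz i + boxVec L s) μ‖ ^ 2
        + (8 * (d : ℝ) ^ 6 * ((L : ℝ) - 1) ^ 6 + 2 * N * (d : ℝ) ^ 5 * ((L : ℝ) - 1) ^ 4 * (L : ℝ) ^ 2) * a i ^ 2 *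
          ∑ s : Fin d → Fin L, ∑ μ : Fin d, ‖G i (cz i + boxVec L s) μ‖ ^ 2 := by
    intro i hi
    have hik : i ≤ k' := by omega
    have h := normSq_osc_le L (V i) (hV i) (ha i) (hplaq i hik) (G i) (cz i)
    simp only [ho₀, hXb]
    exact h
  have hO2 : ∀ i, i < k' + 1 → ‖p₀ i‖ ^ 2 ≤
      N / 2 * (d : ℝ) ^ 2 * ((L : ℝ) - 1) ^ 2 * (L : ℝ) ^ 2 *
          ∑ μ : Fin d, ∑ ν : Fin d, ∑ s ∈ univ.filter (fun s : Fin d → Fin L => (s ν : ℕ) + 1 ≠ L),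
            ‖conjR (V i (cz' i + boxVec L s) ν) (G i (cz' i + boxVec L s + e ν) μ) - G i (cz' i + boxVec L s) μ‖ ^ 2
        + (8 * (d : ℝ) ^ 6 * ((L : ℝ) - 1) ^ 6 + 2 * N * (d : ℝ) ^ 5 * ((L : ℝ) - 1) ^ 4 * (L : ℝ) ^ 2) * a i ^ 2 *
          ∑ s : Fin d → Fin L, ∑ μ : Fin d, ‖G i (cz' i + boxVec L s) μ‖ ^ 2 := by
    intro i hi
    have hik : i ≤ k' := by omega
    have h := normSq_osc_le L (V i) (hV i) (ha i) (hplaq i hik) (G i) (cz' i)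
    refine (normSq_conjR_le huU _).trans ?_
    simp only [hXb']
    exact h
  -- (D) the abstract chain ✓F-6c-3a, instantiated
  have h3a := normSq_covGrad_le_of_rows (ι := Fin d) (E := Matrix (Fin N) (Fin N) ℂ) hL1 hk a₀ b₀ o₀ p₀
    (fun j μ => ((L : ℝ) ^ j)⁻¹ ^ 2 * E j μ) (fun j μ => ((L : ℝ) ^ j)⁻¹ ^ 2 * E' j μ)
    (fun μ => ((L : ℝ) ^ k')⁻¹ ^ 2 *
      (2 * ((L : ℝ) ^ d)⁻¹ * (L : ℝ) * ∑ s : Fin d → Fin L, ∑ t ∈ range L,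
          ‖conjR (V k' ((L : ℤ) • z + boxVec L s + (t : ℤ) • e κ) κ) (G k' ((L : ℤ) • z + boxVec L s + (t : ℤ) • e κ + e κ) μ) - G k' ((L : ℤ) • z + boxVec L s + (t : ℤ) • e κ) μ‖ ^ 2
        + 2 * ((L : ℝ) ^ d)⁻¹ * (8 * (((d : ℝ) + 1) * (L : ℝ)) ^ 2 * a k' + 8 * w) ^ 2 * ∑ s : Fin d → Fin L, ‖G k' ((L : ℤ) • z + (L : ℤ) • e κ + boxVec L s) μ‖ ^ 2))
    (fun i => N / 2 * (d : ℝ) ^ 2 * ((L : ℝ) - 1) ^ 2 * (L : ℝ) ^ 2 *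
          ∑ μ : Fin d, ∑ ν : Fin d, ∑ s ∈ univ.filter (fun s : Fin d → Fin L => (s ν : ℕ) + 1 ≠ L),
            ‖conjR (V i (cz i + boxVec L s) ν) (G i (cz i + boxVec L s + e ν) μ) - G i (cz i + boxVec L s) μ‖ ^ 2
        + (8 * (d : ℝ) ^ 6 * ((L : ℝ) - 1) ^ 6 + 2 * N * (d : ℝ) ^ 5 * ((L : ℝ) - 1) ^ 4 * (L : ℝ) ^ 2) * a i ^ 2 *
          ∑ s : Fin d → Fin L, ∑ μ : Fin d, ‖G i (cz i + boxVec L s) μ‖ ^ 2)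
    (fun i => N / 2 * (d : ℝ) ^ 2 * ((L : ℝ) - 1) ^ 2 * (L : ℝ) ^ 2 *
          ∑ μ : Fin d, ∑ ν : Fin d, ∑ s ∈ univ.filter (fun s : Fin d → Fin L => (s ν : ℕ) + 1 ≠ L),
            ‖conjR (V i (cz' i + boxVec L s) ν) (G i (cz' i + boxVec L s + e ν) μ) - G i (cz' i + boxVec L s) μ‖ ^ 2
        + (8 * (d : ℝ) ^ 6 * ((L : ℝ) - 1) ^ 6 + 2 * N * (d : ℝ) ^ 5 * ((L : ℝ) - 1) ^ 4 * (L : ℝ) ^ 2) * a i ^ 2 *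
          ∑ s : Fin d → Fin L, ∑ μ : Fin d, ‖G i (cz' i + boxVec L s) μ‖ ^ 2)
    hA1 hB1 hP1 hO1 hO2
  -- (E) read the result in the displayed letters
  rw [hLHS]
  have hexp : ∀ j : ℕ, k' + 1 - 2 - j = k' - 1 - j := fun j => by omega
  simp only [Fintype.card_fin, Nat.add_sub_cancel, hexp, hcz, hcz'] at h3a
  linarith [h3a]

end Summit.QuantumFields.YangMills.Theorems.Prop7CornerCombChainPerCornerDressed

end
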